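import Summits.QuantumFields.YangMills.Theorems.BalabanUVNodesN20CoreEdgeShellDialAtKeyReading
import Summits.QuantumFields.YangMills.Theorems.BalabanUVNodesK3V6Defs
import Summits.QuantumFields.YangMills.Theorems.BalabanUVNodesSpineReadingOfRecord13CoPHVSlot
import Summits.QuantumFields.YangMills.Theorems.BalabanUVNodesN20BadDialEliminationAtKeyReading

/-!
# BalabanUVNodes ∕ N20·N21·N19′ — module 13W: module 13U's SOCKET ONE KEY UP — ANY PER-TUPLE HYBRID CERTIFICATE AT THE `kr`-COARSE CARRIERS OF THE RECORD TYPES INTO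
# THE ITEM K3⁸ AT `crOfRecord₁₃K kr ⊥ (its own shells)`: from «at every guarded admissible Stage-13 tuple and every `(g₀, os)`, SOME `shA shB Wsh δ` with `HybridNE7 1 (F.side⁴)
# (classSetK₁₃ θ 0 g₀ (kr …)) (weightAK₁₃ …) (weightBK₁₃ …) ∅ 0 shA shB Wsh δ`» — node U5's binder list READ AT A KEY READING `kr` OF THE PROVER'S CHOICE (any bad class folds in
# first) — plus K4 and the keyed live line, the ROUTE DECL `Theses.BalabanUVNodes.SpineGivenEndpointR13SepCoPHV` BY NAME; a certificate at a coarse key is WEAKER than 13U's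
# fine-key certificate (descent along `kr` is free, dag-n19-w1's rekeying calculus), and it serves the ITEM though not the registered TEXT (whose pin wants the fine key)

Cell `pub-ymgap` (HUMAN RULING D-0062 Track A; D-0149 width push), seat `pub-ymgap-dag-n20-w3` (WIDTH SEAT 3 of 3 on NODE n20 = NE7b) gen 9, CLAIM-2 ∕ INTENT-2
(pub-ymgap INBOX).  Filed `--kind proof --supports stmt-QuantumFields-27366 --as helper` (K3⁸ `SpineGivenEndpointR13SepCoPHV`, skeleton v6 b4e55110ab73e679; dag-lead KEY MAP v2).
COUNT-NEUTRAL.  ADDITIVE — imports this lineage's module 13K `…N20CoreEdgeShellDialAtKeyReading` (p615422: `weightAK₁₃_nonneg_record ∕ weightBK₁₃_nonneg_record`, for §3 only),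
dag-n27-w1's mirror `…K3V6Defs` (p625739: the face predicates, `…V_of_bFree` transfers, `spineGivenEndpointR13SepCoPHV_of_facesV`; through it `K3V5Defs`), dag-n20-d's `…SpineReadingOfRecord13CoPHVSlot` v1.1 (p637963: `keyedExtraction_crOfRecord₁₃KAt_abs`; through it the K edition `…SpineReadingOfRecord13CoPHK` p608328 —
`crOfRecord₁₃K`, `classSetK₁₃ ∕ weightAK₁₃ ∕ weightBK₁₃ ∕ badClassK₁₃`, `shellWeightBound_∕core_crOfRecord₁₃KAt` — and `…SpineCanonicalWeights`' `core_nonneg_of_shellWeightBound`) and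
dag-n20-w1's `…N20BadDialEliminationAtKeyReading` (p617228: `badClassK₁₃_false`, `relWeightBound_crOfRecord₁₃KAt_badFalse`; through it dag-n19-w1's `…N19RekeyingCalculus`
`hybridNE7_foldBad`) — all BY NAME; modifies nothing; independent of the sibling module 13V `…N20CoreEdgeShellDialAtKeyReadingK3V6` (same seat, same day: the ℓ¹-LETTER form).
Inside the theses cone (via `K3V5Defs`) like 13b ∕ 13R ∕ 13T ∕ 13U.  [King1986] = CMP 102, [III] = [Balaban1988Convergent] (locations only).

WHY.  Module 13U (gen 8, p637589) typed «any per-tuple no-bad-class hybrid certificate at the record's FINE carriers `(classSet₁₃, weightA₁₃, weightB₁₃)`» into the REGISTERED TEXT of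
stub 2 at `(0, its own shells)` — the text's pin `PinnedAtLive` wants the fine reading.  The ITEM does not: dag-n27-w1's `spineGivenEndpointR13SepCoPHV_of_facesV` takes ANY spine
reading, and dag-n20-d's key-reading edition `crOfRecord₁₃K kr bd sh` is one for every `kr`.  So a certificate AT THE COARSE CARRIERS of any key reading — the shape every positive
road produces once it is run on the `kr`-classes instead of the σ-packed full histories (dag-n20-w4's class-law road, dag-n20-w5's Hellinger ∕ endpoint roads, dag-n20-w1's conditional
TV chain rule, this lineage's ℓ¹ letters) — serves the four reading-level faces at `crOfRecord₁₃K kr ⊥ (its own shells)` and hence K3⁸ by name: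
* §1 ★★ `exists_facesK_of_keyedHybridNE7NoBadK` — from the keyed coarse certificate `hH` and the keyed live line, a shell split `sh` (classical CHOICE of the certificate's shells at
  guarded admissible tuples, zero shells elsewhere) with, at `crOfRecord₁₃K kr ⊥ sh`: `KeyedRelWeight` (FREE at the empty bad-key reading — dag-n20-w1), `KeyedShellWeight` (the
  certificate's `shell` field, dag-n20-d's transfer — canonical `Wsh` below any witness), `KeyedExtractionBFree` (dag-n20-d's E1 ∕ E2 at every key reading from `LiveSel ∧
  ZetaMeasurable`) and `KeyedCoreEdgeHolderD4BFree β … rr` for EVERY `β`, `rr` (the `core` + `summable` fields through `core_crOfRecord₁₃KAt`, the empty coarse bad class by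
  `badClassK₁₃_false`, non-negative cores from the `shell` field; `PHolderD4` UNREAD under `ForSmallCouplings.of_forall`); ★ `exists_facesK_of_keyedHybridNE7K` — ANY bad class `Bad`,
  weight `W` at the coarse carriers: fold first (`hybridNE7_foldBad`: `Bad ↦ ∅`, `W ↦ 0`, shells absorb the bad terms, `Wsh ↦ W + Wsh`).
* §2 ★★★ `spineGivenEndpointR13SepCoPHV_of_ratesV_of_liveLine_of_keyedHybridNE7NoBadK` ∕ ★★ `…_of_keyedHybridNE7K` (K3⁸ BY NAME from K4 `KeyedRatesHolderD4V β rr` + live line + the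
  keyed coarse certificate) · ★★ `spineGivenEndpointR13SepCoPHV_of_stubRates13HVText_of_liveLine_of_keyedHybridNE7K` (modulo stub 1's REGISTERED v6 text).
* §3 THE WINDOW-KEY-CORE CARD's ASSEMBLY, TYPED (crux card `Ideas/window-key-core.md`: «(YG) + (AC) at the window key, zero shells ⇒ the crux»): ★★
  `keyedHybridNE7K_of_coreLetterK_of_relWeightBoundK` ((YGₖᵣ) ONE centre per step sandwiching the GOOD coarse classes' two weights up to `e^{±F.side⁴·δ_K}`, `Σ δ < ∞`, ZERO shells +
  (ACₖᵣ) a `RelWeightBound` witness on the bad coarse classes ⇒ the keyed certificate, by the tree's `hybridNE7_noShell`) · ★★★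
  `spineGivenEndpointR13SepCoPHV_of_ratesV_of_liveLine_of_coreLetterK_of_relWeightBoundK` (⇒ K3⁸ BY NAME; with `kr := wkey` this is the card's «X ⇒ the crux» for the ITEM —
  dag-n19-w1's `…N19TailLetterAtKeyReading` reads the same two letters as ONE tail letter).
LOCATED (said, not decided): the crux's consumer being index-agnostic, a hybrid certificate at ANY key reading is as good as one at the full-history key for the ITEM; only the
registered TEXT's pin distinguishes them (13N: by exactly (Dev at `kr`)).

HONEST FRAMING.  By-name plumbing + classical choice over the tree's SHAPES; proves NO estimate; `hH` (a hybrid certificate at EVERY guarded admissible tuple, at the `kr`-coarse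
carriers — the two-run content, NOT PRINTED for `d = 4`), the live line and K4 ∕ stub 1's text are HYPOTHESES inhabited for no tuple (K0⁷ `Record13SepCoPHInhabited` OPEN); NOT a
proof of `stub_expansion13HV` nor of K3⁸ (the §2 theorems conclude the decl BY NAME from DISPLAYED hypotheses — audit `proof.conditional`, credits nothing); nothing of Bałaban's
asserted; NE7 ∕ NE7b ∕ NE7c NOT PROVED; N19 ∕ N20 ∕ N21 ∕ N27x NOT discharged; K3⁸ OPEN, v6 STANDS, not claimed; counts unmoved (typed 28∕28 · discharged 5∕27); no count claim.  One
finite `𝕋⁴_{L^K}` programme at fixed `ε = L^{−K}`, Bałaban AS PRINTED — R4 closes the conditional finite-𝕋⁴ rung `BalabanLadder.UV` only; the YM mass gap (Clay) is NOT proved by any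
of this; NOT ℝ⁴, NOT continuum, NOT OS.  No `def`, no `instance`, no `notation`, no `sorry`, no private decls.  Sources (location only): [King1986] (3.10)–(3.13) pp.656–657; [III]
(2.18) p.257, (3.23) p.270.
-/

noncomputable section

open Finset
open scoped BigOperators

namespace Summit.QuantumFields.YangMills.BalabanUVNodes.N20KeyedHybridCertificateAtKeyReadingK3V6

open Literature.MathematicalPhysics.QuantumFieldTheory.Balaban1983to89
open Literature.MathematicalPhysics.QuantumFieldTheory.Balaban1983to89.T4Continuum
open Literature.MathematicalPhysics.QuantumFieldTheory.Balaban1983to89.Node00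
open T4WeightBudget (RelWeightBound)
open T4IndicatorShell (ShellWeightBound)
open T4ContinuumYM4Torus (ForSmallCouplings)
open T4MatchingAssembly (HybridNE7 hybridNE7_noShell)
open Summit.QuantumFields.BalabanUV.T4Continuum.Spine
open YMDAG.UVSplit hiding SU
open Summit.QuantumFields.YangMills.BalabanUVNodes.N20CoreEdgeShellDialAtKeyReading (weightAK₁₃_nonneg_record weightBK₁₃_nonneg_record)
open Summit.QuantumFields.YangMills.Theorems.K3V5Defs (SpineReading RateReadingFn RunSel LetterReading CutReading rrOfRecord GuardedReadingN16
  KeyedRelWeight KeyedShellWeight LiveSel)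
open Summit.QuantumFields.YangMills.Theorems.K3V6Defs (KeyedRatesHolderD4V KeyedCoreEdgeHolderD4BFree KeyedExtractionBFree keyedCoreEdgeHolderD4V_of_bFree
  keyedExtractionV_of_bFree spineGivenEndpointR13SepCoPHV_of_facesV)
open Summit.QuantumFields.YangMills.BalabanUVNodes.N20BadDialEliminationAtKeyReading (badClassK₁₃_false relWeightBound_crOfRecord₁₃KAt_badFalse)
open Summit.QuantumFields.YangMills.BalabanUVNodes.SpineCanonicalWeights (core_nonneg_of_shellWeightBound)
open Summit.QuantumFields.YangMills.BalabanUVNodes.N19RekeyingCalculus (hybridNE7_foldBad)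

variable (kr : KeyReading₁₃ 2 0)

/-! ## §1 The certificate's own shells, chosen per tuple, serve the four reading-level faces at `crOfRecord₁₃K kr ⊥ sh` -/

section Faces

/-- **★★ ANY KEYED NO-BAD-CLASS HYBRID CERTIFICATE AT THE `kr`-COARSE CARRIERS SERVES THE FOUR READING-LEVEL FACES AT `crOfRecord₁₃K kr ⊥ (its own shells)`.**  Hypothesis `hH`:
at every guarded admissible tuple and `(g₀, os)`, SOME `shA shB Wsh δ` with node U5's binder list `HybridNE7 1 (F.side ^ 4) (classSetK₁₃ θ 0 g₀ (kr …)) (weightAK₁₃ …) (weightBK₁₃ …)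
∅ 0 shA shB Wsh δ` — the hybrid AT THE COARSE KEY.  Conclusion: a shell split (choice of the certificate's shells at guarded admissible tuples, `0` elsewhere) with N20 (free at `⊥`,
dag-n20-w1), N21 (the certificate's `shell` field through dag-n20-d's transfer), N27x (the keyed live line, dag-n20-d's `keyedExtraction_crOfRecord₁₃KAt_abs`) and N19′'s (B)-free face
for EVERY `β`, `rr` (the `core` + `summable` fields through `core_crOfRecord₁₃KAt`, the empty coarse bad class by `badClassK₁₃_false`, non-negative cores from the `shell` field;
`PHolderD4` unread).  `hH` is the two-run CONTENT at the coarse key — a HYPOTHESIS. [cite: King1986, (3.10)–(3.13) pp.656–657 (the hybrid binder list, template only)] [bookkeeping] -/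
theorem exists_facesK_of_keyedHybridNE7NoBadK
    (hlive : ∀ (F : T4Family) (θ : Stage13HParams F 2), θ.Provisos₁₃CoPH F 2 → (θ.ZhUnity F 2 ∧ θ.SlotsNondegenerate₁₃ F 2) → θ.Admissible F 2 →
      LiveSel F θ ∧ ZetaMeasurable F 2 θ.ζ)
    (hH : ∀ (F : T4Family) (θ : Stage13HParams F 2) (hP : θ.Provisos₁₃CoPH F 2), (θ.ZhUnity F 2 ∧ θ.SlotsNondegenerate₁₃ F 2) → θ.Admissible F 2 →
      ∀ (g₀ : ℕ → ℝ) (os : List (ULoop F)),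
        letI : DecidableEq (Σ K, SiteSeqKey F (0 + K)) := Classical.decEq _
        ∃ (shA shB : ℕ → ℝ → (Σ K, SiteSeqKey F (0 + K)) → ℝ) (Wsh δ : ℕ → ℝ),
          HybridNE7 1 (F.side ^ 4) (classSetK₁₃ θ 0 g₀ (kr F θ hP g₀ os)) (weightAK₁₃ θ hP 0 g₀ os (kr F θ hP g₀ os)) (weightBK₁₃ θ hP 0 g₀ os (kr F θ hP g₀ os))
            (fun _ _ => ∅) (fun _ => 0) shA shB Wsh δ) :
    ∃ sh : ShellSplit₁₃CoPH 2 0,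
      KeyedRelWeight (crOfRecord₁₃K kr (fun _ _ _ _ _ _ _ => False) sh) ∧ KeyedShellWeight (crOfRecord₁₃K kr (fun _ _ _ _ _ _ _ => False) sh) ∧
      KeyedExtractionBFree (crOfRecord₁₃K kr (fun _ _ _ _ _ _ _ => False) sh) ∧
      ∀ (β : ℝ) (rr : RateReadingFn), KeyedCoreEdgeHolderD4BFree β (crOfRecord₁₃K kr (fun _ _ _ _ _ _ _ => False) sh) rr := by
  -- the certificate's shells at guarded admissible tuples, zero shells elsewhere (classical case split on the guard, no global `classical`)
  let sh : ShellSplit₁₃CoPH 2 0 := fun F θ hP g₀ os =>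
    @dite _ ((θ.ZhUnity F 2 ∧ θ.SlotsNondegenerate₁₃ F 2) ∧ θ.Admissible F 2) (Classical.dec _)
      (fun h => ((hH F θ hP h.1 h.2 g₀ os).choose, (hH F θ hP h.1 h.2 g₀ os).choose_spec.choose))
      (fun _ => (fun _ _ _ => 0, fun _ _ _ => 0))
  have hsh : ∀ (F : T4Family) (θ : Stage13HParams F 2) (hP : θ.Provisos₁₃CoPH F 2) (hG : θ.ZhUnity F 2 ∧ θ.SlotsNondegenerate₁₃ F 2) (hθ : θ.Admissible F 2)
      (g₀ : ℕ → ℝ) (os : List (ULoop F)),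
      sh F θ hP g₀ os = ((hH F θ hP hG hθ g₀ os).choose, (hH F θ hP hG hθ g₀ os).choose_spec.choose) := fun F θ hP hG hθ g₀ os =>
    dif_pos (show (θ.ZhUnity F 2 ∧ θ.SlotsNondegenerate₁₃ F 2) ∧ θ.Admissible F 2 from ⟨hG, hθ⟩)
  -- the certificate at a guarded admissible tuple, read at `sh`'s components
  have hcert : ∀ (F : T4Family) (θ : Stage13HParams F 2) (hP : θ.Provisos₁₃CoPH F 2) (hG : θ.ZhUnity F 2 ∧ θ.SlotsNondegenerate₁₃ F 2) (hθ : θ.Admissible F 2)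
      (g₀ : ℕ → ℝ) (os : List (ULoop F)),
      letI : DecidableEq (Σ K, SiteSeqKey F (0 + K)) := Classical.decEq _
      ∃ Wsh δ : ℕ → ℝ, HybridNE7 1 (F.side ^ 4) (classSetK₁₃ θ 0 g₀ (kr F θ hP g₀ os)) (weightAK₁₃ θ hP 0 g₀ os (kr F θ hP g₀ os))
        (weightBK₁₃ θ hP 0 g₀ os (kr F θ hP g₀ os)) (fun _ _ => ∅) (fun _ => 0) (sh F θ hP g₀ os).1 (sh F θ hP g₀ os).2 Wsh δ := fun F θ hP hG hθ g₀ os => by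
    rw [hsh F θ hP hG hθ g₀ os]
    exact (hH F θ hP hG hθ g₀ os).choose_spec.choose_spec
  refine ⟨sh, fun _ θ hP _ _ g₀ os => relWeightBound_crOfRecord₁₃KAt_badFalse 0 kr sh θ hP g₀ os, ?_, ?_, ?_⟩
  · -- N21: the certificate's shell face, transferred to the reading's canonical `Wsh`
    intro F θ hP hG hθ g₀ os
    letI : DecidableEq (Σ K, SiteSeqKey F (0 + K)) := Classical.decEq _
    obtain ⟨Wsh, δ, hHy⟩ := hcert F θ hP hG hθ g₀ os
    exact shellWeightBound_crOfRecord₁₃KAt 0 kr (fun _ _ _ _ _ _ _ => False) sh θ hP g₀ os hHy.shell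
  · -- N27x: E1 ∕ E2 at the key reading from the keyed live line
    intro F θ hP hG hθ
    obtain ⟨hsel, hζm⟩ := hlive F θ hP hG hθ
    exact keyedExtraction_crOfRecord₁₃KAt_abs 0 kr (fun _ _ _ _ _ _ _ => False) sh θ hP (EOfRecord₁₃ F 2 θ.toStage13Params) hsel hζm
  · -- N19′ (B)-free + U4′: the certificate's core and summable fields at the empty coarse bad class
    intro β rr F θ hP hG hθ
    refine ForSmallCouplings.of_forall fun g₀ os _ => ?_
    letI : DecidableEq (Σ K, SiteSeqKey F (0 + K)) := Classical.decEq _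
    obtain ⟨Wsh, δ, hHy⟩ := hcert F θ hP hG hθ g₀ os
    have hbad : badClassK₁₃ θ 0 g₀ (kr F θ hP g₀ os) (fun _ _ => False) = fun _ _ => (∅ : Finset (Σ K, SiteSeqKey F (0 + K))) :=
      funext fun K => funext fun t => badClassK₁₃_false 0 θ g₀ (kr F θ hP g₀ os) K t
    have hP0 : ∀ (K : ℕ) (t : ℝ), |t| ≤ 1 → ∀ u ∈ classSetK₁₃ θ 0 g₀ (kr F θ hP g₀ os) K \ badClassK₁₃ θ 0 g₀ (kr F θ hP g₀ os) (fun _ _ => False) K t,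
        0 ≤ weightAK₁₃ θ hP 0 g₀ os (kr F θ hP g₀ os) K t u - (sh F θ hP g₀ os).1 K t u := by
      rw [hbad]
      exact core_nonneg_of_shellWeightBound (Bad := fun _ _ => ∅) hHy.shell
    have hcore : NE7.Core 1 (F.side ^ 4) (classSetK₁₃ θ 0 g₀ (kr F θ hP g₀ os)) (badClassK₁₃ θ 0 g₀ (kr F θ hP g₀ os) (fun _ _ => False))
        (fun K t u => weightAK₁₃ θ hP 0 g₀ os (kr F θ hP g₀ os) K t u - (sh F θ hP g₀ os).1 K t u)
        (fun K t u => weightBK₁₃ θ hP 0 g₀ os (kr F θ hP g₀ os) K t u - (sh F θ hP g₀ os).2 K t u) δ := by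
      rw [hbad]
      exact hHy.core
    exact ⟨_, core_crOfRecord₁₃KAt 0 kr (fun _ _ _ _ _ _ _ => False) sh θ hP g₀ os hP0 hcore hHy.summable⟩

/-- **★ … WITH ANY BAD CLASS AT THE COARSE CARRIERS**: a keyed certificate `HybridNE7 … Bad W shA shB Wsh δ` with an arbitrary bad class of coarse classes per tuple serves the same
four faces — fold the bad terms into the shells first (dag-n19-w1's `hybridNE7_foldBad`: `Bad ↦ ∅`, `W ↦ 0`, `Wsh ↦ W + Wsh`, same `δ`).  In particular a certificate whose bad class is
`badClassK₁₃ … bd` for some bad-key reading `bd` (N20's witness at `(kr, bd)` among its fields) lands at `(kr, ⊥)` — dag-n20-w1's bad-dial elimination, certificate form. [bookkeeping] -/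
theorem exists_facesK_of_keyedHybridNE7K
    (hlive : ∀ (F : T4Family) (θ : Stage13HParams F 2), θ.Provisos₁₃CoPH F 2 → (θ.ZhUnity F 2 ∧ θ.SlotsNondegenerate₁₃ F 2) → θ.Admissible F 2 →
      LiveSel F θ ∧ ZetaMeasurable F 2 θ.ζ)
    (hH : ∀ (F : T4Family) (θ : Stage13HParams F 2) (hP : θ.Provisos₁₃CoPH F 2), (θ.ZhUnity F 2 ∧ θ.SlotsNondegenerate₁₃ F 2) → θ.Admissible F 2 →
      ∀ (g₀ : ℕ → ℝ) (os : List (ULoop F)),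
        letI : DecidableEq (Σ K, SiteSeqKey F (0 + K)) := Classical.decEq _
        ∃ (Bad : ℕ → ℝ → Finset (Σ K, SiteSeqKey F (0 + K))) (W : ℕ → ℝ) (shA shB : ℕ → ℝ → (Σ K, SiteSeqKey F (0 + K)) → ℝ) (Wsh δ : ℕ → ℝ),
          HybridNE7 1 (F.side ^ 4) (classSetK₁₃ θ 0 g₀ (kr F θ hP g₀ os)) (weightAK₁₃ θ hP 0 g₀ os (kr F θ hP g₀ os)) (weightBK₁₃ θ hP 0 g₀ os (kr F θ hP g₀ os))
            Bad W shA shB Wsh δ) :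
    ∃ sh : ShellSplit₁₃CoPH 2 0,
      KeyedRelWeight (crOfRecord₁₃K kr (fun _ _ _ _ _ _ _ => False) sh) ∧ KeyedShellWeight (crOfRecord₁₃K kr (fun _ _ _ _ _ _ _ => False) sh) ∧
      KeyedExtractionBFree (crOfRecord₁₃K kr (fun _ _ _ _ _ _ _ => False) sh) ∧
      ∀ (β : ℝ) (rr : RateReadingFn), KeyedCoreEdgeHolderD4BFree β (crOfRecord₁₃K kr (fun _ _ _ _ _ _ _ => False) sh) rr := by
  refine exists_facesK_of_keyedHybridNE7NoBadK kr hlive fun F θ hP hG hθ g₀ os => ?_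
  letI : DecidableEq (Σ K, SiteSeqKey F (0 + K)) := Classical.decEq _
  obtain ⟨Bad, W, shA, shB, Wsh, δ, h⟩ := hH F θ hP hG hθ g₀ os
  exact ⟨_, _, _, _, hybridNE7_foldBad h⟩

end Faces

/-! ## §2 K3⁸ by name from K4 + the keyed live line + the keyed coarse certificate -/

section Item

/-- **★★★ K3⁸ BY NAME FROM K4, THE KEYED LIVE LINE AND A KEYED NO-BAD-CLASS HYBRID CERTIFICATE AT THE `kr`-COARSE CARRIERS** (§1 ∘ the mirror's
`spineGivenEndpointR13SepCoPHV_of_facesV` at `(β, crOfRecord₁₃K kr ⊥ sh, rr)`).  Module 13U read the certificate at the FINE key into the TEXT; here ANY key reading serves the ITEM.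
NOT a proof of K3⁸ (`hH`, the live line and K4 are DISPLAYED; `proof.conditional`). [cite: King1986, (3.10)–(3.13) pp.656–657 (template only)] [bookkeeping] -/
theorem spineGivenEndpointR13SepCoPHV_of_ratesV_of_liveLine_of_keyedHybridNE7NoBadK (β : ℝ) (rr : RateReadingFn) (hr : KeyedRatesHolderD4V β rr)
    (hlive : ∀ (F : T4Family) (θ : Stage13HParams F 2), θ.Provisos₁₃CoPH F 2 → (θ.ZhUnity F 2 ∧ θ.SlotsNondegenerate₁₃ F 2) → θ.Admissible F 2 →
      LiveSel F θ ∧ ZetaMeasurable F 2 θ.ζ)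
    (hH : ∀ (F : T4Family) (θ : Stage13HParams F 2) (hP : θ.Provisos₁₃CoPH F 2), (θ.ZhUnity F 2 ∧ θ.SlotsNondegenerate₁₃ F 2) → θ.Admissible F 2 →
      ∀ (g₀ : ℕ → ℝ) (os : List (ULoop F)),
        letI : DecidableEq (Σ K, SiteSeqKey F (0 + K)) := Classical.decEq _
        ∃ (shA shB : ℕ → ℝ → (Σ K, SiteSeqKey F (0 + K)) → ℝ) (Wsh δ : ℕ → ℝ),
          HybridNE7 1 (F.side ^ 4) (classSetK₁₃ θ 0 g₀ (kr F θ hP g₀ os)) (weightAK₁₃ θ hP 0 g₀ os (kr F θ hP g₀ os)) (weightBK₁₃ θ hP 0 g₀ os (kr F θ hP g₀ os))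
            (fun _ _ => ∅) (fun _ => 0) shA shB Wsh δ) :
    Summit.QuantumFields.YangMills.Theses.BalabanUVNodes.SpineGivenEndpointR13SepCoPHV := by
  obtain ⟨sh, h20, h21, hx, h19⟩ := exists_facesK_of_keyedHybridNE7NoBadK kr hlive hH
  exact spineGivenEndpointR13SepCoPHV_of_facesV β (crOfRecord₁₃K kr (fun _ _ _ _ _ _ _ => False) sh) rr h20 h21 hr (keyedCoreEdgeHolderD4V_of_bFree (h19 β rr))
    (keyedExtractionV_of_bFree hx)

/-- **★★ … FROM A KEYED HYBRID CERTIFICATE WITH ANY BAD CLASS AT THE COARSE CARRIERS** (fold first, §1). [bookkeeping] -/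
theorem spineGivenEndpointR13SepCoPHV_of_ratesV_of_liveLine_of_keyedHybridNE7K (β : ℝ) (rr : RateReadingFn) (hr : KeyedRatesHolderD4V β rr)
    (hlive : ∀ (F : T4Family) (θ : Stage13HParams F 2), θ.Provisos₁₃CoPH F 2 → (θ.ZhUnity F 2 ∧ θ.SlotsNondegenerate₁₃ F 2) → θ.Admissible F 2 →
      LiveSel F θ ∧ ZetaMeasurable F 2 θ.ζ)
    (hH : ∀ (F : T4Family) (θ : Stage13HParams F 2) (hP : θ.Provisos₁₃CoPH F 2), (θ.ZhUnity F 2 ∧ θ.SlotsNondegenerate₁₃ F 2) → θ.Admissible F 2 →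
      ∀ (g₀ : ℕ → ℝ) (os : List (ULoop F)),
        letI : DecidableEq (Σ K, SiteSeqKey F (0 + K)) := Classical.decEq _
        ∃ (Bad : ℕ → ℝ → Finset (Σ K, SiteSeqKey F (0 + K))) (W : ℕ → ℝ) (shA shB : ℕ → ℝ → (Σ K, SiteSeqKey F (0 + K)) → ℝ) (Wsh δ : ℕ → ℝ),
          HybridNE7 1 (F.side ^ 4) (classSetK₁₃ θ 0 g₀ (kr F θ hP g₀ os)) (weightAK₁₃ θ hP 0 g₀ os (kr F θ hP g₀ os)) (weightBK₁₃ θ hP 0 g₀ os (kr F θ hP g₀ os))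
            Bad W shA shB Wsh δ) :
    Summit.QuantumFields.YangMills.Theses.BalabanUVNodes.SpineGivenEndpointR13SepCoPHV := by
  obtain ⟨sh, h20, h21, hx, h19⟩ := exists_facesK_of_keyedHybridNE7K kr hlive hH
  exact spineGivenEndpointR13SepCoPHV_of_facesV β (crOfRecord₁₃K kr (fun _ _ _ _ _ _ _ => False) sh) rr h20 h21 hr (keyedCoreEdgeHolderD4V_of_bFree (h19 β rr))
    (keyedExtractionV_of_bFree hx)

/-- **★★ THE ITEM MODULO STUB 1's REGISTERED v6 TEXT** (`stub_rates13HV`; its `β`-window and N16-guard rows are unread, its last conjunct feeds the previous theorem) from the keyed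
live line and a keyed hybrid certificate with any bad class at the `kr`-coarse carriers.  NOT a proof of K3⁸, credits nothing. [bookkeeping] -/
theorem spineGivenEndpointR13SepCoPHV_of_stubRates13HVText_of_liveLine_of_keyedHybridNE7K
    (h₁ : ∃ β : ℝ, 2 / 3 < β ∧ β < 1 ∧
      ∃ (𝔯 : RateReading₁₃CoPH 2) (ksel : RunSel) (ℓ : LetterReading) (ℓ₃ : T4Family → Node00.NE3Letters₁₁) (g B : T4Family → ℝ),
        GuardedReadingN16 𝔯 ksel ℓ ℓ₃ g B ∧ KeyedRatesHolderD4V β (rrOfRecord 𝔯 ksel))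
    (hlive : ∀ (F : T4Family) (θ : Stage13HParams F 2), θ.Provisos₁₃CoPH F 2 → (θ.ZhUnity F 2 ∧ θ.SlotsNondegenerate₁₃ F 2) → θ.Admissible F 2 →
      LiveSel F θ ∧ ZetaMeasurable F 2 θ.ζ)
    (hH : ∀ (F : T4Family) (θ : Stage13HParams F 2) (hP : θ.Provisos₁₃CoPH F 2), (θ.ZhUnity F 2 ∧ θ.SlotsNondegenerate₁₃ F 2) → θ.Admissible F 2 →
      ∀ (g₀ : ℕ → ℝ) (os : List (ULoop F)),
        letI : DecidableEq (Σ K, SiteSeqKey F (0 + K)) := Classical.decEq _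
        ∃ (Bad : ℕ → ℝ → Finset (Σ K, SiteSeqKey F (0 + K))) (W : ℕ → ℝ) (shA shB : ℕ → ℝ → (Σ K, SiteSeqKey F (0 + K)) → ℝ) (Wsh δ : ℕ → ℝ),
          HybridNE7 1 (F.side ^ 4) (classSetK₁₃ θ 0 g₀ (kr F θ hP g₀ os)) (weightAK₁₃ θ hP 0 g₀ os (kr F θ hP g₀ os)) (weightBK₁₃ θ hP 0 g₀ os (kr F θ hP g₀ os))
            Bad W shA shB Wsh δ) :
    Summit.QuantumFields.YangMills.Theses.BalabanUVNodes.SpineGivenEndpointR13SepCoPHV := by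
  obtain ⟨β, -, -, 𝔯, ksel, _ℓ, _ℓ₃, _g, _B, -, hr⟩ := h₁
  exact spineGivenEndpointR13SepCoPHV_of_ratesV_of_liveLine_of_keyedHybridNE7K kr β (rrOfRecord 𝔯 ksel) hr hlive hH

end Item

/-! ## §3 The window-key-core card's assembly, typed: (YGₖᵣ) a zero-shell `Core` letter + (ACₖᵣ) a weight letter AT THE KEY READING ⇒ the certificate ⇒ K3⁸ by name -/

section WindowRoad

variable (bd : BadKeyReading₁₃ 2 0)

/-- **★★ THE CARD's TWO LETTERS AT A KEY READING ARE A KEYED HYBRID CERTIFICATE THERE** (crux card `Cruxes/SpineGivenEndpointR13SepCoPH/Ideas/window-key-core.md`, assembly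
«(YG) + (AC) at the window key, zero shells»; here for ANY key reading `kr` and bad-key reading `bd`): per guarded admissible tuple and `(g₀, os)`, (ACₖᵣ) a `RelWeightBound`
witness `W` at the `kr`-carriers with coarse bad class `badClassK₁₃ … bd` and (YGₖᵣ) a ZERO-SHELL core letter — ONE centre `c_K` per step with `e^{c_K − F.side⁴·δ_K}·weightAK₁₃ u
≤ weightBK₁₃ u ≤ e^{c_K + F.side⁴·δ_K}·weightAK₁₃ u` on every GOOD coarse class `u`, `|t| ≤ 1`, `Σ δ < ∞` — give node U5's binder list at the coarse carriers with zero shells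
(the tree's `T4MatchingAssembly.hybridNE7_noShell`; non-negative coarse weights from dag-n20-d's `weightAK₁₃_nonneg ∕ weightBK₁₃_nonneg` on dag-n21's `weightA₁₃_nonneg`).  Both
letters are the two-run content at the coarse key — HYPOTHESES, NOT PRINTED for `d = 4` (dag-n19-w1's `…N19TailLetterAtKeyReading` reads the same pair as ONE tail letter).
[cite: Balaban1989LargeFieldII, (1.80) p.384 (the pending window; template only)] [bookkeeping] -/
theorem keyedHybridNE7K_of_coreLetterK_of_relWeightBoundK
    (hAC : ∀ (F : T4Family) (θ : Stage13HParams F 2) (hP : θ.Provisos₁₃CoPH F 2), (θ.ZhUnity F 2 ∧ θ.SlotsNondegenerate₁₃ F 2) → θ.Admissible F 2 →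
      ∀ (g₀ : ℕ → ℝ) (os : List (ULoop F)),
        letI : DecidableEq (Σ K, SiteSeqKey F (0 + K)) := Classical.decEq _
        ∃ W δ : ℕ → ℝ,
        RelWeightBound 1 (classSetK₁₃ θ 0 g₀ (kr F θ hP g₀ os)) (weightAK₁₃ θ hP 0 g₀ os (kr F θ hP g₀ os)) (weightBK₁₃ θ hP 0 g₀ os (kr F θ hP g₀ os))
          (badClassK₁₃ θ 0 g₀ (kr F θ hP g₀ os) (bd F θ hP g₀ os)) W ∧ Summable δ ∧
        ∀ K : ℕ, ∃ c : ℝ, ∀ t : ℝ, |t| ≤ 1 →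
          ∀ u ∈ classSetK₁₃ θ 0 g₀ (kr F θ hP g₀ os) K \ badClassK₁₃ θ 0 g₀ (kr F θ hP g₀ os) (bd F θ hP g₀ os) K t,
            Real.exp (c - (F.side : ℝ) ^ 4 * δ K) * weightAK₁₃ θ hP 0 g₀ os (kr F θ hP g₀ os) K t u ≤ weightBK₁₃ θ hP 0 g₀ os (kr F θ hP g₀ os) K t u ∧
            weightBK₁₃ θ hP 0 g₀ os (kr F θ hP g₀ os) K t u ≤ Real.exp (c + (F.side : ℝ) ^ 4 * δ K) * weightAK₁₃ θ hP 0 g₀ os (kr F θ hP g₀ os) K t u) :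
    ∀ (F : T4Family) (θ : Stage13HParams F 2) (hP : θ.Provisos₁₃CoPH F 2), (θ.ZhUnity F 2 ∧ θ.SlotsNondegenerate₁₃ F 2) → θ.Admissible F 2 →
      ∀ (g₀ : ℕ → ℝ) (os : List (ULoop F)),
        letI : DecidableEq (Σ K, SiteSeqKey F (0 + K)) := Classical.decEq _
        ∃ (Bad : ℕ → ℝ → Finset (Σ K, SiteSeqKey F (0 + K))) (W : ℕ → ℝ) (shA shB : ℕ → ℝ → (Σ K, SiteSeqKey F (0 + K)) → ℝ) (Wsh δ : ℕ → ℝ),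
          HybridNE7 1 (F.side ^ 4) (classSetK₁₃ θ 0 g₀ (kr F θ hP g₀ os)) (weightAK₁₃ θ hP 0 g₀ os (kr F θ hP g₀ os)) (weightBK₁₃ θ hP 0 g₀ os (kr F θ hP g₀ os))
            Bad W shA shB Wsh δ := by
  intro F θ hP hG hθ g₀ os
  letI : DecidableEq (Σ K, SiteSeqKey F (0 + K)) := Classical.decEq _
  obtain ⟨W, δ, hW, hδ, hgood⟩ := hAC F θ hP hG hθ g₀ os
  exact ⟨_, W, _, _, _, δ, hybridNE7_noShell hW
    (fun K t _ u _ => weightAK₁₃_nonneg_record 0 kr θ hP g₀ os K t u) (fun K t _ u _ => weightBK₁₃_nonneg_record 0 kr θ hP g₀ os K t u) hδ hgood⟩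

/-- **★★★ K3⁸ BY NAME FROM K4, THE KEYED LIVE LINE AND THE WINDOW-KEY-CORE CARD's TWO LETTERS READ AT THE KEY READING `kr`** — (YGₖᵣ) the zero-shell core letter on the good
coarse classes + (ACₖᵣ) the weight letter on the bad ones (previous theorem ∘ §2's any-bad-class socket: the bad coarse classes fold into shells at `(kr, ⊥)`).  With `kr := wkey` the
window key (dag-n20-d's `windowKeyReading₁₃`, or the card's D1 region-relative window once declared) this is the card's assembly «X ⇒ the crux» as a theorem about the ITEM; the
registered TEXT is not served (its pin wants the full-history key).  NOT a proof of K3⁸: (YGₖᵣ), (ACₖᵣ), the live line and K4 are DISPLAYED hypotheses (`proof.conditional`).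
[cite: Balaban1989LargeFieldII, (1.80) p.384; Balaban1988Convergent, p.244 (the small-fraction window; templates only)] [bookkeeping] -/
theorem spineGivenEndpointR13SepCoPHV_of_ratesV_of_liveLine_of_coreLetterK_of_relWeightBoundK (β : ℝ) (rr : RateReadingFn) (hr : KeyedRatesHolderD4V β rr)
    (hlive : ∀ (F : T4Family) (θ : Stage13HParams F 2), θ.Provisos₁₃CoPH F 2 → (θ.ZhUnity F 2 ∧ θ.SlotsNondegenerate₁₃ F 2) → θ.Admissible F 2 →
      LiveSel F θ ∧ ZetaMeasurable F 2 θ.ζ)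
    (hAC : ∀ (F : T4Family) (θ : Stage13HParams F 2) (hP : θ.Provisos₁₃CoPH F 2), (θ.ZhUnity F 2 ∧ θ.SlotsNondegenerate₁₃ F 2) → θ.Admissible F 2 →
      ∀ (g₀ : ℕ → ℝ) (os : List (ULoop F)),
        letI : DecidableEq (Σ K, SiteSeqKey F (0 + K)) := Classical.decEq _
        ∃ W δ : ℕ → ℝ,
        RelWeightBound 1 (classSetK₁₃ θ 0 g₀ (kr F θ hP g₀ os)) (weightAK₁₃ θ hP 0 g₀ os (kr F θ hP g₀ os)) (weightBK₁₃ θ hP 0 g₀ os (kr F θ hP g₀ os))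
          (badClassK₁₃ θ 0 g₀ (kr F θ hP g₀ os) (bd F θ hP g₀ os)) W ∧ Summable δ ∧
        ∀ K : ℕ, ∃ c : ℝ, ∀ t : ℝ, |t| ≤ 1 →
          ∀ u ∈ classSetK₁₃ θ 0 g₀ (kr F θ hP g₀ os) K \ badClassK₁₃ θ 0 g₀ (kr F θ hP g₀ os) (bd F θ hP g₀ os) K t,
            Real.exp (c - (F.side : ℝ) ^ 4 * δ K) * weightAK₁₃ θ hP 0 g₀ os (kr F θ hP g₀ os) K t u ≤ weightBK₁₃ θ hP 0 g₀ os (kr F θ hP g₀ os) K t u ∧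
            weightBK₁₃ θ hP 0 g₀ os (kr F θ hP g₀ os) K t u ≤ Real.exp (c + (F.side : ℝ) ^ 4 * δ K) * weightAK₁₃ θ hP 0 g₀ os (kr F θ hP g₀ os) K t u) :
    Summit.QuantumFields.YangMills.Theses.BalabanUVNodes.SpineGivenEndpointR13SepCoPHV :=
  spineGivenEndpointR13SepCoPHV_of_ratesV_of_liveLine_of_keyedHybridNE7K kr β rr hr hlive (keyedHybridNE7K_of_coreLetterK_of_relWeightBoundK kr bd hAC)

end WindowRoad

end Summit.QuantumFields.YangMills.BalabanUVNodes.N20KeyedHybridCertificateAtKeyReadingK3V6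

end
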